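import Mathlib
import HarnessLib
import Summits.QuantumFields.YangMills.Theses.CoincidenceRotationBootstrap
import Summits.QuantumFields.YangMills.Theorems.LangevinControlUVOSLegsFromFemtoAndGapStubUpgradeGivens
import Literature.Analysis.FunctionSpaces.SchwartzParametric

/-!
# Stub `stub_upgrade` of crux `OSLegsFromFemtoAndGap` (stmt-QuantumFields-9367), line `dlr-collar-transfer`

The stub is the route item `CoincidenceRotationBootstrap.EuclideanUpgrade` (stmt-QuantumFields-8647):
for any label type `ι` and any labelled Schwinger family `S` on `ℝ⁴`, invariance of every `S n k` on `⁰𝒮`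
under (HYP-CUBIC) the proper signed permutations (determinant-one isometries permuting the axes up to sign)
and under (HYP-Σ5) the rational rotation `R` of the `(x₂,x₃)`-plane with `cos = 3/5`, `sin = 4/5`
implies invariance on `⁰𝒮` under EVERY determinant-one linear isometry of `ℝ⁴` (the rotation half of
Osterwalder–Schrader's E1).

Proof: the group theory (closed subgroups of `ℝ`, Niven's theorem, conjugation of the Σ5 rotation into the
`(x₀,x₁)`-plane, Givens generation) is `Upgrade.of_hyper_of_sigma5` of
`LangevinControlUVOSLegsFromFemtoAndGapStubUpgradeGivens.lean`, applied to the predicate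
`P A := ∀ n k F, IsOffDiagonal F → S n k (linActMulti A F) = S n k F`, which is closed under composition and
inverses (`linActMulti` is an action preserving `⁰𝒮`), and for which `{t | P (ρ t)}` (`ρ t = planeRot 0 t` the
`(x₀,x₁)`-rotation) is closed: `t ↦ linActMulti (ρ t) F` is continuous into `𝓢` (tree:
`SchwartzMap.continuous_compCLMOfContinuousLinearEquiv_apply`, the family `t ↦ diag (ρ (-t))` being
operator-norm continuous by finite dimension, Mathlib `continuous_clm_apply`), and each `S n k` is continuous.

References: Osterwalder–Schrader 1973 §2 (E1); I. Niven, Irrational Numbers (1956), Cor. 3.12; folklore.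
No definitions, no notation.
-/

noncomputable section

namespace Summit.QuantumFields.YangMills.Theorems.OSLegsFromFemtoAndGap.Upgrade

open scoped SchwartzMap
open Literature.MathematicalPhysics.QuantumLattice Literature.MathematicalPhysics.AQFT
  Literature.MathematicalPhysics.QuantumFieldTheory
open Summit.QuantumFields.YangMills.Theorems.NPointIsotropy.Negative (E4)

variable {n : ℕ}

/-- **`⁰𝒮` is stable under `linActMulti R`** (the coincidence locus is invariant under the diagonal action;
derivatives of `F ∘ Λ` are those of `F` composed with `Λ`). [folklore] -/
theorem isOffDiagonal_linActMulti (R : E4 ≃ₗᵢ[ℝ] E4) {F : 𝓢((Fin n → E4), ℂ)} (hF : IsOffDiagonal F) :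
    IsOffDiagonal (linActMulti R F) := by
  intro x hx k
  set g : (Fin n → E4) ≃L[ℝ] (Fin n → E4) :=
    ContinuousLinearEquiv.piCongrRight fun _ : Fin n => R.symm.toContinuousLinearEquiv with hg
  have hfun : ((linActMulti R F : 𝓢((Fin n → E4), ℂ)) : (Fin n → E4) → ℂ) = (F : (Fin n → E4) → ℂ) ∘ g := by
    funext y
    rfl
  have hgx : g x ∈ coincidenceLocus n E4 := by
    obtain ⟨i, j, hij, hxij⟩ := hx
    exact ⟨i, j, hij, by simp [hg, hxij]⟩
  have key := (g : (Fin n → E4) →L[ℝ] (Fin n → E4)).iteratedFDeriv_comp_right (F.smooth k) x (i := k) le_rfl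
  simp only [ContinuousLinearEquiv.coe_coe] at key
  rw [hfun, key, hF _ hgx k]
  ext m
  simp

/-- `linActMulti` is an action: `F_{(0, A then B)} = (F_{(0,A)})_{(0,B)}`. [folklore] -/
theorem linActMulti_trans_eq (A B : E4 ≃ₗᵢ[ℝ] E4) (F : 𝓢((Fin n → E4), ℂ)) :
    linActMulti (A.trans B) F = linActMulti B (linActMulti A F) := by
  ext x
  simp only [linActMulti_apply]
  congr 1

/-- The identity acts trivially. [folklore] -/
theorem linActMulti_refl_eq (F : 𝓢((Fin n → E4), ℂ)) :
    linActMulti (LinearIsometryEquiv.refl ℝ E4) F = F := by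
  ext x
  simp only [linActMulti_apply]
  congr 1

/-- The diagonal action of `ρ t` on configurations is jointly continuous in `(t, x)`. [folklore] -/
theorem continuous_rho_diag :
    Continuous fun p : ℝ × (Fin n → E4) => fun k => (planeRot (d := 3) 0 p.1) (p.2 k) :=
  continuous_planeRot_diag (d := 3) (n := n) 0

/-- **The rotation orbit of a test function is continuous in the Schwartz topology**:
`t ↦ F ∘ diag (ρ t)⁻¹` is continuous `ℝ → 𝓢((ℝ⁴)ⁿ)`. [folklore] -/
theorem continuous_linActMulti_rho (F : 𝓢((Fin n → E4), ℂ)) :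
    Continuous fun t : ℝ => linActMulti (planeRot (d := 3) 0 t : E4 ≃ₗᵢ[ℝ] E4) F := by
  have hc : Continuous fun t : ℝ => ((ContinuousLinearEquiv.piCongrRight
      fun _ : Fin n => (planeRot (d := 3) 0 t : E4 ≃ₗᵢ[ℝ] E4).symm.toContinuousLinearEquiv :
        (Fin n → E4) ≃L[ℝ] (Fin n → E4)) : (Fin n → E4) →L[ℝ] (Fin n → E4)) := by
    refine continuous_clm_apply.2 fun y => ?_
    have h : (fun t : ℝ => ((ContinuousLinearEquiv.piCongrRight
        fun _ : Fin n => (planeRot (d := 3) 0 t : E4 ≃ₗᵢ[ℝ] E4).symm.toContinuousLinearEquiv :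
          (Fin n → E4) ≃L[ℝ] (Fin n → E4)) : (Fin n → E4) →L[ℝ] (Fin n → E4)) y) =
        fun t => fun k => (planeRot (d := 3) 0 (-t)) (y k) := by
      funext t
      funext k
      simp only [ContinuousLinearEquiv.coe_coe, ContinuousLinearEquiv.piCongrRight_apply,
        LinearIsometryEquiv.coe_toContinuousLinearEquiv]
      exact rho_symm_apply t (y k)
    rw [h]
    exact continuous_rho_diag.comp₂ continuous_neg continuous_const
  exact SchwartzMap.continuous_compCLMOfContinuousLinearEquiv_apply ℂ _ hc F

variable {ι : Type}

/-- **Euclidean upgrade** (the content of `CoincidenceRotationBootstrap.EuclideanUpgrade`): proper-hypercubic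
and Σ5 invariance of a labelled Schwinger family on `⁰𝒮` give invariance under every determinant-one linear
isometry of `ℝ⁴`. [cite: Niven1956, Cor. 3.12] -/
theorem upgrade (S : LabelledSchwingerFamily ι E4)
    (hcubic : ∀ (n : ℕ) (k : Fin n → ι) (R : E4 ≃ₗᵢ[ℝ] E4),
      LinearMap.det (R.toLinearEquiv : E4 →ₗ[ℝ] E4) = 1 →
      (∀ i : Fin 4, ∃ j : Fin 4, R (EuclideanSpace.single i 1) = EuclideanSpace.single j 1 ∨
        R (EuclideanSpace.single i 1) = -EuclideanSpace.single j 1) →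
      ∀ F : 𝓢((Fin n → E4), ℂ), IsOffDiagonal F → S n k (linActMulti R F) = S n k F)
    (hsigma : ∀ R : E4 ≃ₗᵢ[ℝ] E4, (R (EuclideanSpace.single 0 1) = EuclideanSpace.single 0 1 ∧
      R (EuclideanSpace.single 1 1) = EuclideanSpace.single 1 1 ∧
      R (EuclideanSpace.single 2 1) =
        (3 / 5 : ℝ) • EuclideanSpace.single 2 1 + (4 / 5 : ℝ) • EuclideanSpace.single 3 1 ∧
      R (EuclideanSpace.single 3 1) =
        -((4 / 5 : ℝ) • EuclideanSpace.single 2 1) + (3 / 5 : ℝ) • EuclideanSpace.single 3 1) →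
      ∀ (n : ℕ) (k : Fin n → ι) (F : 𝓢((Fin n → E4), ℂ)), IsOffDiagonal F →
        S n k (linActMulti R F) = S n k F)
    (n : ℕ) (k : Fin n → ι) (R : E4 ≃ₗᵢ[ℝ] E4) (hR : LinearMap.det (R.toLinearEquiv : E4 →ₗ[ℝ] E4) = 1)
    (F : 𝓢((Fin n → E4), ℂ)) (hF : IsOffDiagonal F) : S n k (linActMulti R F) = S n k F := by
  have key := of_hyper_of_sigma5
    (fun A : E4 ≃ₗᵢ[ℝ] E4 => ∀ (n : ℕ) (k : Fin n → ι) (F : 𝓢((Fin n → E4), ℂ)),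
      IsOffDiagonal F → S n k (linActMulti A F) = S n k F) ?_ ?_ ?_ ?_ ?_ ?_ R hR
  · exact key n k F hF
  · -- closed under composition
    intro A B hA hB n k F hF
    rw [linActMulti_trans_eq, hB n k _ (isOffDiagonal_linActMulti A hF), hA n k F hF]
  · -- closed under inverses
    intro A hA n k F hF
    have h := hA n k _ (isOffDiagonal_linActMulti A.symm hF)
    rw [← linActMulti_trans_eq, LinearIsometryEquiv.symm_trans_self, linActMulti_refl_eq] at h
    exact h.symm
  · -- identity
    intro n k F _
    rw [linActMulti_refl_eq]
  · -- closed along the `(x₀,x₁)`-rotations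
    have h : IsClosed (⋂ (n : ℕ), ⋂ (k : Fin n → ι), ⋂ (F : 𝓢((Fin n → E4), ℂ)), ⋂ (_ : IsOffDiagonal F),
        {t : ℝ | S n k (linActMulti (planeRot (d := 3) 0 t : E4 ≃ₗᵢ[ℝ] E4) F) = S n k F}) :=
      isClosed_iInter fun n => isClosed_iInter fun k => isClosed_iInter fun F =>
        isClosed_iInter fun _ =>
          isClosed_eq ((S n k).continuous.comp (continuous_linActMulti_rho F)) continuous_const
    convert h using 1
    ext t
    simp only [Set.mem_setOf_eq, Set.mem_iInter]
  · -- proper signed permutations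
    intro A hA hp n k F hF
    exact hcubic n k A hA hp F hF
  · -- the Σ5 rotation
    intro A hA n k F hF
    exact hsigma A hA n k F hF

end Summit.QuantumFields.YangMills.Theorems.OSLegsFromFemtoAndGap.Upgrade

namespace Summit.QuantumFields.YangMills.Cruxes.OSLegsFromFemtoAndGap.DlrCollarTransfer

open Summit.QuantumFields.YangMills.Theses.CoincidenceRotationBootstrap (EuclideanUpgrade)

/-- **Stub `stub_upgrade`** of line `dlr-collar-transfer` (crux `OSLegsFromFemtoAndGap`, stmt-QuantumFields-9367)
= route item `CoincidenceRotationBootstrap.EuclideanUpgrade` (stmt-QuantumFields-8647): proper-hypercubic + Σ5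
invariance on `⁰𝒮` ⇒ invariance under every determinant-one linear isometry of `ℝ⁴`. [cite: Niven1956, Cor. 3.12] -/
theorem stub_upgrade : EuclideanUpgrade := by
  unfold Summit.QuantumFields.YangMills.Theses.CoincidenceRotationBootstrap.EuclideanUpgrade
  intro E ι S hcubic hsigma n k R hR F hF
  exact Summit.QuantumFields.YangMills.Theorems.OSLegsFromFemtoAndGap.Upgrade.upgrade S hcubic hsigma n k R hR
    F hF

end Summit.QuantumFields.YangMills.Cruxes.OSLegsFromFemtoAndGap.DlrCollarTransfer

end
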